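import Summits.Ventures.PercRepro.SevenThreeWorld

/-!
# PercRepro — the `(7,3)` cell: the dual closure in the reduced world (p3, gen 16)

The dual rank `drk E Z = ρ(E ∖ Z) + |Z| − ρ(E)` of `SevenThreeSeries.lean` is the rank function of the dual matroid
on the world `E = T ∪ W`: monotone (`drk_mono`), submodular (`drk_submod`), with unit increments
(`drk_insert_le`). Its closure `dcl Z = {e ∈ E : drk (insert e Z) = drk Z}` (`dcl`) has the usual properties:
`Z ⊆ dcl Z`, `drk (dcl Z) = drk Z` (`drk_dcl`), and any `Z' ⊆ dcl Z` of the same dual rank has the same closure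
(`dcl_eq_of_subset`). The cyclic part of the witness `E ∖ Z` is the complement of the closure:
`cyclicPart (E ∖ Z) = E ∖ dcl Z` (`cyclicPart_sdiff_eq`) — so the witnesses of nullity one (`drk Z = 2`) are grouped
by the LINE `λ = dcl Z` of the dual, and a witness with `Z' ⊆ λ`, `drk Z' = 2` belongs to the fibre of `λ`
(`P3-C025-seven-three-plan.md` §9 (R3)(a)).
-/

namespace PercRepro

namespace SevenThree

open Finset ThmH SixThree

variable {α : Type*} [DecidableEq α] {M : Matroid α} [M.Finite]

/-- `drk` is monotone on subsets of `A`. -/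
theorem drk_mono {A V V' : Finset α} (hV : V ⊆ V') : drk M A V ≤ drk M A V' := by
  have h1 := nrk_sdiff_add_card_eq (M := M) A V
  have h2 := nrk_sdiff_add_card_eq (M := M) A V'
  have h3 : nrk M (A \ V) ≤ nrk M (A \ V') + (V' \ V).card := by
    have := nrk_le_nrk_sdiff_add_card (M := M) (A \ V) (V' \ V)
    have heq : (A \ V) \ (V' \ V) = A \ V' := by
      ext x
      simp only [Finset.mem_sdiff, not_and, not_not]
      constructor
      · rintro ⟨⟨hx, hxV⟩, h⟩
        exact ⟨hx, fun hV' => hxV (h hV')⟩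
      · rintro ⟨hx, hxV'⟩
        exact ⟨⟨hx, fun hxV => hxV' (hV hxV)⟩, fun hV' => absurd hV' hxV'⟩
    rw [heq] at this
    exact this
  have h4 : (V' \ V).card + V.card = V'.card := by
    rw [Finset.card_sdiff_of_subset hV]
    have := Finset.card_le_card hV
    omega
  omega

/-- `drk (insert e V) ≤ drk V + 1`. -/
theorem drk_insert_le (A V : Finset α) (e : α) : drk M A (insert e V) ≤ drk M A V + 1 := by
  by_cases he : e ∈ V
  · rw [Finset.insert_eq_of_mem he]
    omega
  have h1 := nrk_sdiff_add_card_eq (M := M) A V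
  have h2 := nrk_sdiff_add_card_eq (M := M) A (insert e V)
  have h3 : nrk M (A \ V) ≤ nrk M (A \ insert e V) + 1 := by
    have := nrk_le_nrk_sdiff_add_card (M := M) (A \ V) {e}
    have heq : (A \ V) \ {e} = A \ insert e V := by
      ext x
      simp only [Finset.mem_sdiff, Finset.mem_singleton, Finset.mem_insert, not_or]
      tauto
    rw [heq, Finset.card_singleton] at this
    exact this
  rw [Finset.card_insert_of_notMem he] at h2
  have h5 : nrk M (A \ insert e V) ≤ nrk M (A \ V) :=
    nrk_mono (Finset.sdiff_subset_sdiff (Finset.Subset.refl _) (Finset.subset_insert e V))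
  omega

/-- **Submodularity of the dual rank** on subsets of `A`. -/
theorem drk_submod (A V V' : Finset α) : drk M A (V ∪ V') + drk M A (V ∩ V') ≤ drk M A V + drk M A V' := by
  have h1 := nrk_sdiff_add_card_eq (M := M) A V
  have h2 := nrk_sdiff_add_card_eq (M := M) A V'
  have h3 := nrk_sdiff_add_card_eq (M := M) A (V ∪ V')
  have h4 := nrk_sdiff_add_card_eq (M := M) A (V ∩ V')
  have hsub := nrk_submod (M := M) (A \ V) (A \ V')
  have hinter : (A \ V) ∩ (A \ V') = A \ (V ∪ V') := by
    ext x
    simp only [Finset.mem_inter, Finset.mem_sdiff, Finset.mem_union, not_or]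
    tauto
  have hunion : (A \ V) ∪ (A \ V') = A \ (V ∩ V') := by
    ext x
    simp only [Finset.mem_union, Finset.mem_sdiff, Finset.mem_inter, not_and]
    tauto
  rw [hinter, hunion] at hsub
  have hcard := Finset.card_union_add_card_inter V V'
  omega

/-- The DUAL CLOSURE of `Z` in the world: the points whose addition keeps the dual rank. -/
noncomputable def dcl (M : Matroid α) [M.Finite] (T W Z : Finset α) : Finset α :=
  (T ∪ W).filter (fun e => drk M (T ∪ W) (insert e Z) = drk M (T ∪ W) Z)

/-- Membership in the dual closure. -/
theorem mem_dcl {T W Z : Finset α} {e : α} :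
    e ∈ dcl M T W Z ↔ e ∈ T ∪ W ∧ drk M (T ∪ W) (insert e Z) = drk M (T ∪ W) Z := by
  unfold dcl
  rw [Finset.mem_filter]

/-- `dcl Z ⊆ E`. -/
theorem dcl_subset (T W Z : Finset α) : dcl M T W Z ⊆ T ∪ W := Finset.filter_subset _ _

/-- `Z ⊆ dcl Z` for `Z ⊆ E`. -/
theorem subset_dcl {T W Z : Finset α} (hZ : Z ⊆ T ∪ W) : Z ⊆ dcl M T W Z := by
  intro e he
  rw [mem_dcl, Finset.insert_eq_of_mem he]
  exact ⟨hZ he, rfl⟩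

/-- Adding a set of closure points keeps the dual rank: `drk (Z ∪ A) = drk Z` for `A ⊆ dcl Z`. -/
theorem drk_union_eq_of_subset_dcl {T W Z A : Finset α} (hA : A ⊆ dcl M T W Z) :
    drk M (T ∪ W) (Z ∪ A) = drk M (T ∪ W) Z := by
  classical
  induction A using Finset.induction_on with
  | empty => rw [Finset.union_empty]
  | insert e A heA ih =>
    have hA' : A ⊆ dcl M T W Z := (Finset.subset_insert e A).trans hA
    have ih' := ih hA'
    have he := (mem_dcl.1 (hA (Finset.mem_insert_self e A))).2
    -- submodularity on `Z ∪ A` and `insert e Z`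
    have hsub := drk_submod (M := M) (T ∪ W) (Z ∪ A) (insert e Z)
    have hunion : (Z ∪ A) ∪ insert e Z = Z ∪ insert e A := by
      ext x
      simp only [Finset.mem_union, Finset.mem_insert]
      tauto
    have hinter : Z ⊆ (Z ∪ A) ∩ insert e Z := by
      intro x hx
      exact Finset.mem_inter.2 ⟨Finset.mem_union_left A hx, Finset.mem_insert_of_mem hx⟩
    have hmono := drk_mono (M := M) (A := T ∪ W) hinter
    have hmono' := drk_mono (M := M) (A := T ∪ W) (Finset.subset_union_left : Z ⊆ Z ∪ insert e A)
    rw [hunion] at hsub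
    omega

/-- `drk (dcl Z) = drk Z` for `Z ⊆ E`. -/
theorem drk_dcl {T W Z : Finset α} (hZ : Z ⊆ T ∪ W) : drk M (T ∪ W) (dcl M T W Z) = drk M (T ∪ W) Z := by
  have := drk_union_eq_of_subset_dcl (M := M) (T := T) (W := W) (Z := Z) (A := dcl M T W Z) (Finset.Subset.refl _)
  rw [Finset.union_eq_right.2 (subset_dcl hZ)] at this
  exact this

/-- **The closure is determined by any spanning subset**: for `Z' ⊆ dcl Z` with `drk Z' = drk Z`, `dcl Z' = dcl Z`. -/
theorem dcl_eq_of_subset {T W Z Z' : Finset α} (hZ : Z ⊆ T ∪ W) (hZ' : Z' ⊆ dcl M T W Z)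
    (hd : drk M (T ∪ W) Z' = drk M (T ∪ W) Z) : dcl M T W Z' = dcl M T W Z := by
  have hZ'E : Z' ⊆ T ∪ W := hZ'.trans (dcl_subset T W Z)
  ext e
  rw [mem_dcl, mem_dcl]
  constructor
  · rintro ⟨heE, he⟩
    refine ⟨heE, ?_⟩
    -- `drk (insert e (dcl Z)) ≤ drk (dcl Z) + drk (insert e Z') − drk Z' = drk Z`
    have hsub := drk_submod (M := M) (T ∪ W) (dcl M T W Z) (insert e Z')
    have hunion : dcl M T W Z ∪ insert e Z' = insert e (dcl M T W Z) := by
      ext x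
      simp only [Finset.mem_union, Finset.mem_insert]
      constructor
      · rintro (hx | hx | hx)
        · exact Or.inr hx
        · exact Or.inl hx
        · exact Or.inr (hZ' hx)
      · rintro (hx | hx)
        · exact Or.inr (Or.inl hx)
        · exact Or.inl hx
    have hinter : Z' ⊆ dcl M T W Z ∩ insert e Z' := fun x hx =>
      Finset.mem_inter.2 ⟨hZ' hx, Finset.mem_insert_of_mem hx⟩
    have hmono := drk_mono (M := M) (A := T ∪ W) hinter
    rw [hunion, drk_dcl hZ] at hsub
    have h1 : drk M (T ∪ W) (insert e Z) ≤ drk M (T ∪ W) (insert e (dcl M T W Z)) :=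
      drk_mono (Finset.insert_subset_insert e (subset_dcl hZ))
    have h2 : drk M (T ∪ W) Z ≤ drk M (T ∪ W) (insert e Z) := drk_mono (Finset.subset_insert e Z)
    omega
  · rintro ⟨heE, he⟩
    refine ⟨heE, ?_⟩
    have h1 : drk M (T ∪ W) (insert e Z') ≤ drk M (T ∪ W) (dcl M T W Z) := by
      apply drk_mono
      apply Finset.insert_subset _ hZ'
      rw [mem_dcl]
      exact ⟨heE, he⟩
    have h2 : drk M (T ∪ W) Z' ≤ drk M (T ∪ W) (insert e Z') := drk_mono (Finset.subset_insert e Z')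
    rw [drk_dcl hZ] at h1
    omega

/-- The dual closure is closed: `dcl (dcl Z) = dcl Z`. -/
theorem dcl_dcl {T W Z : Finset α} (hZ : Z ⊆ T ∪ W) : dcl M T W (dcl M T W Z) = dcl M T W Z :=
  dcl_eq_of_subset hZ (Finset.Subset.refl _) (drk_dcl hZ)

/-- **The cyclic part of a witness is the complement of the dual closure**: `cyclicPart (E ∖ Z) = E ∖ dcl Z`. -/
theorem cyclicPart_sdiff_eq {T W Z : Finset α} (h : ReducedWorld M T W) (hr : M.eRank = 7) :
    cyclicPart M ((T ∪ W) \ Z) = (T ∪ W) \ dcl M T W Z := by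
  ext e
  rw [mem_cyclicPart_iff_nrk (Finset.sdiff_subset.trans (world_subset h)), Finset.mem_sdiff, Finset.mem_sdiff,
    mem_dcl]
  constructor
  · rintro ⟨⟨heE, heZ⟩, hrk⟩
    have he : e ∈ (T ∪ W) \ Z := Finset.mem_sdiff.2 ⟨heE, heZ⟩
    refine ⟨heE, fun hh => ?_⟩
    have := (mem_coloopsOf_sdiff_iff h hr he).2 hh.2
    rw [mem_coloopsOf_iff_nrk (Finset.sdiff_subset.trans (world_subset h))] at this
    omega
  · rintro ⟨heE, hh⟩
    have heZ : e ∉ Z := fun hz => hh ⟨heE, by rw [Finset.insert_eq_of_mem hz]⟩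
    have he : e ∈ (T ∪ W) \ Z := Finset.mem_sdiff.2 ⟨heE, heZ⟩
    refine ⟨⟨heE, heZ⟩, ?_⟩
    have hnot : e ∉ coloopsOf M ((T ∪ W) \ Z) := fun hc => hh ⟨heE, (mem_coloopsOf_sdiff_iff h hr he).1 hc⟩
    rw [mem_coloopsOf_iff_nrk (Finset.sdiff_subset.trans (world_subset h))] at hnot
    have h1 := nrk_erase_le (M := M) ((T ∪ W) \ Z) e
    have h2 := nrk_le_nrk_erase_add_one (M := M) ((T ∪ W) \ Z) e
    by_contra hne
    exact hnot ⟨he, by omega⟩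

/-- A series class of the world meeting `dcl Z` outside `L₀` lies in `dcl Z`: the dual closure is a union of classes
(with `drk (dcl Z) ≤ 2`… in general: `f` in series with `e ∈ dcl Z` is in `dcl Z`). -/
theorem mem_dcl_of_ser {T W Z : Finset α} (h : ReducedWorld M T W) {e f : α}
    (he : e ∈ dcl M T W Z) (hecyc : e ∈ cyclicPart M (T ∪ W)) (hf : f ∈ cyclicPart M (T ∪ W))
    (hser : Ser M (T ∪ W) e f) : f ∈ dcl M T W Z := by
  have hE := world_subset h
  rw [mem_dcl]
  refine ⟨cyclicPart_subset M _ hf, ?_⟩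
  by_cases hef : e = f
  · subst hef
    exact (mem_dcl.1 he).2
  -- `drk {e, f} = 1`: `drk (insert f (insert e Z)) ≤ drk (insert e Z) + drk {e,f} − drk {e} = drk Z`
  have hpair : drk M (T ∪ W) {e, f} = 1 :=
    drk_eq_one_of_pairwise_ser hE (Finset.insert_subset hecyc (Finset.singleton_subset_iff.2 hf)) ⟨e, by simp⟩
      (fun a ha b hb => by
        simp only [Finset.mem_insert, Finset.mem_singleton] at ha hb
        rcases ha with rfl | rfl <;> rcases hb with rfl | rfl
        · exact ser_refl _ _
        · exact hser
        · exact ser_symm hser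
        · exact ser_refl _ _)
  have hsingle : drk M (T ∪ W) {e} = 1 := one_le_drk_of_nonempty hE (Finset.singleton_subset_iff.2 hecyc)
    ⟨e, Finset.mem_singleton_self e⟩ |>.antisymm' (by
      have := drk_mono (M := M) (A := T ∪ W) (Finset.singleton_subset_iff.2 (Finset.mem_insert_self e {f}) :
        ({e} : Finset α) ⊆ {e, f})
      omega)
  have hsub := drk_submod (M := M) (T ∪ W) (insert e Z) {e, f}
  have hunion : insert e Z ∪ {e, f} = insert f (insert e Z) := by
    ext x
    simp only [Finset.mem_union, Finset.mem_insert, Finset.mem_singleton]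
    tauto
  have hinter : ({e} : Finset α) ⊆ insert e Z ∩ {e, f} := by
    intro x hx
    rw [Finset.mem_singleton] at hx
    subst hx
    exact Finset.mem_inter.2 ⟨Finset.mem_insert_self _ _, Finset.mem_insert_self _ _⟩
  have hmono := drk_mono (M := M) (A := T ∪ W) hinter
  rw [hunion, hpair, (mem_dcl.1 he).2] at hsub
  rw [hsingle] at hmono
  have h1 : drk M (T ∪ W) (insert f Z) ≤ drk M (T ∪ W) (insert f (insert e Z)) :=
    drk_mono (Finset.insert_subset_insert f (Finset.subset_insert e Z))
  have h2 : drk M (T ∪ W) Z ≤ drk M (T ∪ W) (insert f Z) := drk_mono (Finset.subset_insert f Z)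
  omega

end SevenThree

end PercRepro
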